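import Mathlib
import Summits.NavierStokesRegularity.NavierStokesRegularity.Theorems.EulerZoomLiouvillePowerGaugeEulerLiouvilleWeakVorticityRenormCommutator
import Summits.NavierStokesRegularity.NavierStokesRegularity.Theorems.EulerZoomLiouvillePowerGaugeEulerLiouvilleWeakVorticityRenormIdentity
import Summits.NavierStokesRegularity.NavierStokesRegularity.Theorems.EulerZoomLiouvillePowerGaugeEulerLiouvilleWeakVorticityRenormTools
import HarnessLib

/-!
# Crux `EulerZoomLiouville.PowerGaugeEulerLiouville` (stmt-NavierStokesRegularity-19832), weak stratum, line `weak_eulerian` (E2):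
# THE DIPERNA–LIONS RENORMALISATION THEOREM FOR THE WEAK VECTOR TRANSPORT EQUATION (class-free)

Route №10 `EulerZoomLiouville` (NavierStokesRegularity), crux E = stmt-NavierStokesRegularity-19832; width seat ns-ezl-w2 g7 under the LEAD ns-typeII-p2.
Fifth brick of `stub_renormalisation` (E2) — the theorem itself, CLASS-FREE: let `Θ ∈ L²_loc(ℝ³; ℝ³)`, `W ∈ L²_loc` with a whole-space weak
gradient `DW ∈ L²_loc`, `tr DW = c` a.e. and `∫⟪W, ∇θ⟫ = −c∫θ` for tests (`div W = c`), `S ∈ L¹_loc`, and suppose the componentwise weak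
transport equation `∫ ⟪Θ, e⟫ Dψ[W] = ∫ ψ ⟪S, e⟫` for all tests `ψ` and all `e` (`div(W ⊗ Θ) = −S` in `𝒟′`).  Then for every
`β ∈ C¹(ℝ³; ℝ)` bounded with bounded derivative and every test `ψ`:

  `∫ β(Θ)(cψ + Dψ[W]) = ∫ ψ Dβ(Θ)[cΘ + S]`      (`hasRenormalised_core`)

i.e. `div(W β(Θ)) = c β(Θ) − Dβ(Θ)[cΘ + S]` in `𝒟′` — `Θ` IS A RENORMALISED SOLUTION.  Proof (DiPerna–Lions 1989, Thm. II.1): mollify with a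
fixed-shape bump sequence, `Θₙ = φ̃ₙ ⋆ Θ`, `Sₙ = φ̃ₙ ⋆ S`, vector commutator `sₙ = DΘₙ[W] + cΘₙ + Sₙ → 0` in `L¹_loc`
(`tendsto_setLIntegral_commutatorVec`, over the DiPerna–Lions commutator lemma `DiPernaLionsCommutatorL2_holds`); the `C¹` identity
`∫ β(Θₙ)(cψ + Dψ[W]) = −∫ ψ Dβ(Θₙ)[DΘₙ[W]] = ∫ ψ Dβ(Θₙ)[cΘₙ + Sₙ − sₙ]` (`renormalised_identity_vec`); `Θₙ → Θ` a.e. (Lebesgue differentiation,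
Mathlib `ContDiffBump.ae_convolution_tendsto_right_of_locallyIntegrable`) and in `L¹_loc`, `Sₙ → S` in `L¹_loc` (`tendsto_setLIntegral_mollify_sub`);
dominated convergence on both sides (`tendsto_integral_comp_mul_of_ae_tendsto`, `tendsto_integral_test_mul_clm_apply`); uniqueness of limits.
[folklore; DiPernaLions1989 Thm. II.1 and Lemma II.1]

WHAT THIS IS NOT: not NS, not E; the member (E2 with the line's binders) is the next file; 19832 is OPEN.
-/

noncomputable section

-- flat `Theorems/<Route><Decl>…` files of one crux share the namespace of the crux (tree convention)
set_option linter.dupNamespace false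

open MeasureTheory Set Filter Topology Metric Function TopologicalSpace ContinuousLinearMap
open scoped ENNReal NNReal RealInnerProductSpace ContDiff Convolution

namespace Summit.NavierStokesRegularity.NavierStokesRegularity.Theorems.PowerGaugeEulerLiouville.WeakEulerian

open Literature.Analysis Literature.Analysis.FunctionSpaces Literature.Analysis.FluidPDE
open Summit.NavierStokesRegularity.NavierStokesRegularity.Theorems.PowerGaugeEulerLiouville

section Tools

/-- A continuous linear-map-valued function applied to an `L¹_loc` field is `L¹_loc`: `y ↦ L(y)[W y]`. [folklore] -/
theorem locallyIntegrable_clm_apply {F : Type*} [NormedAddCommGroup F] [NormedSpace ℝ F]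
    {L : EuclideanSpace ℝ (Fin 3) → EuclideanSpace ℝ (Fin 3) →L[ℝ] F}
    {W : EuclideanSpace ℝ (Fin 3) → EuclideanSpace ℝ (Fin 3)} (hL : Continuous L) (hW : LocallyIntegrable W volume) :
    LocallyIntegrable (fun y => L y (W y)) volume := by
  have hm : AEStronglyMeasurable (fun y => L y (W y)) volume :=
    Continuous.comp_aestronglyMeasurable₂
      (g := fun (L : EuclideanSpace ℝ (Fin 3) →L[ℝ] F) (v : EuclideanSpace ℝ (Fin 3)) => L v)
      (isBoundedBilinearMap_apply (𝕜 := ℝ) (E := EuclideanSpace ℝ (Fin 3)) (F := F)).continuous hL.aestronglyMeasurable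
      hW.aestronglyMeasurable
  have hf : LocallyIntegrable (fun y => ‖L y‖ • W y) volume := by
    have h := (hW.locallyIntegrableOn univ).continuousOn_smul isClosed_univ.isLocallyClosed
      (continuous_norm.comp hL).continuousOn
    exact (locallyIntegrableOn_univ).1 h
  refine hf.mono hm (Eventually.of_forall fun y => ?_)
  rw [norm_smul, norm_norm]
  exact (L y).le_opNorm _

end Tools

section Core

variable {W Θ S : EuclideanSpace ℝ (Fin 3) → EuclideanSpace ℝ (Fin 3)}
  {DW : EuclideanSpace ℝ (Fin 3) → EuclideanSpace ℝ (Fin 3) →L[ℝ] EuclideanSpace ℝ (Fin 3)} {c : ℝ}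

/-- **THE DIPERNA–LIONS RENORMALISATION THEOREM FOR `div(W ⊗ Θ) = −S`, `div W = c` (class-free, `L² × W^{1,2}`, local).**
See the module docstring. [folklore; DiPernaLions1989 Thm. II.1] -/
theorem hasRenormalised_core
    (hΘ2 : ∀ r : ℝ, MemLp Θ 2 (volume.restrict (ball (0 : EuclideanSpace ℝ (Fin 3)) r)))
    (hW2 : ∀ r : ℝ, MemLp W 2 (volume.restrict (ball (0 : EuclideanSpace ℝ (Fin 3)) r)))
    (hDW : HasWeakFDerivOn (⊤ : Opens (EuclideanSpace ℝ (Fin 3))) volume W DW)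
    (hDW2 : ∀ r : ℝ, MemLp DW 2 (volume.restrict (ball (0 : EuclideanSpace ℝ (Fin 3)) r)))
    (htr : ∀ᵐ y ∂(volume : Measure (EuclideanSpace ℝ (Fin 3))),
      LinearMap.trace ℝ (EuclideanSpace ℝ (Fin 3)) (DW y : EuclideanSpace ℝ (Fin 3) →ₗ[ℝ] EuclideanSpace ℝ (Fin 3)) = c)
    (hdiv : ∀ θ : EuclideanSpace ℝ (Fin 3) → ℝ, IsTestFunctionOn (⊤ : Opens (EuclideanSpace ℝ (Fin 3))) θ →
      ∫ y, ⟪W y, gradient θ y⟫ = -c * ∫ y, θ y)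
    (hS : LocallyIntegrable S volume)
    (heq : ∀ ψ : EuclideanSpace ℝ (Fin 3) → ℝ, IsTestFunctionOn (⊤ : Opens (EuclideanSpace ℝ (Fin 3))) ψ →
      ∀ e : EuclideanSpace ℝ (Fin 3), ∫ y, ⟪Θ y, e⟫ * fderiv ℝ ψ y (W y) = ∫ y, ψ y * ⟪S y, e⟫)
    {β : EuclideanSpace ℝ (Fin 3) → ℝ} (hβ : ContDiff ℝ 1 β) {C : ℝ} (hβb : ∀ w, ‖β w‖ ≤ C) (hβ'b : ∀ w, ‖fderiv ℝ β w‖ ≤ C)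
    {ψ : EuclideanSpace ℝ (Fin 3) → ℝ} (hψ : IsTestFunctionOn (⊤ : Opens (EuclideanSpace ℝ (Fin 3))) ψ) :
    ∫ y, β (Θ y) * (c * ψ y + fderiv ℝ ψ y (W y)) = ∫ y, ψ y * fderiv ℝ β (Θ y) (c • Θ y + S y) := by
  obtain ⟨φ, hφ, hφ2⟩ := exists_fixedShape_bumpSeq
  -- ### data
  have hΘ : LocallyIntegrable Θ volume := locallyIntegrable_of_memLp_two_ball_vec hΘ2
  have hWl : LocallyIntegrable W volume := locallyIntegrable_of_memLp_two_ball_vec hW2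
  have hψc : Continuous ψ := hψ.contDiff.continuous
  have hψs : HasCompactSupport ψ := hψ.hasCompactSupport
  have hDψc : Continuous (fderiv ℝ ψ) := hψ.contDiff.continuous_fderiv (by simp)
  have hβc : Continuous β := hβ.continuous
  have hDβc : Continuous (fderiv ℝ β) := hβ.continuous_fderiv one_ne_zero
  obtain ⟨R, hR⟩ : ∃ R : ℝ, tsupport ψ ⊆ ball (0 : EuclideanSpace ℝ (Fin 3)) R := hψs.isCompact.isBounded.subset_ball 0
  have hψR : support ψ ⊆ ball (0 : EuclideanSpace ℝ (Fin 3)) R := (subset_tsupport ψ).trans hR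
  -- ### the mollified objects
  obtain ⟨Θn, hΘn⟩ : ∃ Θn : ℕ → EuclideanSpace ℝ (Fin 3) → EuclideanSpace ℝ (Fin 3),
      Θn = fun n => (φ n).normed volume ⋆[lsmul ℝ ℝ, volume] Θ := ⟨_, rfl⟩
  obtain ⟨Sn, hSn⟩ : ∃ Sn : ℕ → EuclideanSpace ℝ (Fin 3) → EuclideanSpace ℝ (Fin 3),
      Sn = fun n => (φ n).normed volume ⋆[lsmul ℝ ℝ, volume] S := ⟨_, rfl⟩
  obtain ⟨s, hs⟩ : ∃ s : ℕ → EuclideanSpace ℝ (Fin 3) → EuclideanSpace ℝ (Fin 3),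
      s = fun n y => fderiv ℝ (Θn n) y (W y) + c • Θn n y + Sn n y := ⟨_, rfl⟩
  have hφt : ∀ n, IsTestFunctionOn (⊤ : Opens (EuclideanSpace ℝ (Fin 3))) ((φ n).normed volume) := fun n =>
    ⟨(φ n).contDiff_normed, (φ n).hasCompactSupport_normed, by simp⟩
  have hΘnC1 : ∀ n, ContDiff ℝ 1 (Θn n) := fun n => by
    rw [hΘn]; exact contDiff_convolution_of_test hΘ (hφt n)
  have hΘnc : ∀ n, Continuous (Θn n) := fun n => (hΘnC1 n).continuous
  have hDΘnc : ∀ n, Continuous (fderiv ℝ (Θn n)) := fun n => (hΘnC1 n).continuous_fderiv one_ne_zero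
  have hSnc : ∀ n, Continuous (Sn n) := fun n => by
    rw [hSn]; exact (φ n).hasCompactSupport_normed.continuous_convolution_left _ (φ n).continuous_normed hS
  have hΘnm : ∀ n, AEStronglyMeasurable (Θn n) volume := fun n => (hΘnc n).aestronglyMeasurable
  have hsl : ∀ n, LocallyIntegrable (s n) volume := fun n => by
    rw [hs]
    exact ((locallyIntegrable_clm_apply (hDΘnc n) hWl).add ((hΘnc n).const_smul c).locallyIntegrable).add
      (hSnc n).locallyIntegrable
  -- ### (I) the identity for each `n`
  have hI : ∀ n, ∫ y, β (Θn n y) * (c * ψ y + fderiv ℝ ψ y (W y)) =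
      ∫ y, ψ y * fderiv ℝ β (Θn n y) (c • Θn n y + Sn n y - s n y) := by
    intro n
    rw [renormalised_identity_vec hWl hdiv (hΘnC1 n) hβ hψ, ← integral_neg]
    refine integral_congr_ae (Eventually.of_forall fun y => ?_)
    have e : fderiv ℝ (Θn n) y (W y) = -(c • Θn n y + Sn n y - s n y) := by
      simp only [hs]; abel
    dsimp only
    rw [e, map_neg]
    ring
  -- ### (II) the left-hand sides converge
  have hh : Integrable (fun y => c * ψ y + fderiv ℝ ψ y (W y)) volume :=
    ((hψc.integrable_of_hasCompactSupport hψs).const_mul c).add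
      (WeakEulerian.integrable_clm_apply_of_locallyIntegrable hDψc (hψs.fderiv (𝕜 := ℝ)) hWl)
  have hae : ∀ᵐ y ∂(volume : Measure (EuclideanSpace ℝ (Fin 3))), Tendsto (fun n => Θn n y) atTop (𝓝 (Θ y)) := by
    rw [hΘn]
    exact ContDiffBump.ae_convolution_tendsto_right_of_locallyIntegrable hφ (Eventually.of_forall fun n => (hφ2 n).le) hΘ
  have hL : Tendsto (fun n => ∫ y, β (Θn n y) * (c * ψ y + fderiv ℝ ψ y (W y))) atTop
      (𝓝 (∫ y, β (Θ y) * (c * ψ y + fderiv ℝ ψ y (W y)))) :=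
    tendsto_integral_comp_mul_of_ae_tendsto hΘnm hae hβc hβb hh
  -- ### (III) the right-hand sides converge
  have hAm : ∀ n, AEStronglyMeasurable (fun y => fderiv ℝ β (Θn n y)) volume := fun n =>
    (hDβc.comp (hΘnc n)).aestronglyMeasurable
  have hAt : ∀ᵐ y ∂(volume : Measure (EuclideanSpace ℝ (Fin 3))),
      Tendsto (fun n => fderiv ℝ β (Θn n y)) atTop (𝓝 (fderiv ℝ β (Θ y))) :=
    hae.mono fun y hy => (hDβc.tendsto _).comp hy
  have hXl : ∀ n, LocallyIntegrable (fun y => c • Θn n y + Sn n y - s n y) volume := fun n =>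
    ((((hΘnc n).const_smul c).locallyIntegrable).add (hSnc n).locallyIntegrable).sub (hsl n)
  have hX'l : LocallyIntegrable (fun y => c • Θ y + S y) volume := (hΘ.smul c).add hS
  -- the three `L¹_loc` limits
  have hT1 : Tendsto (fun n => ∫⁻ y in ball (0 : EuclideanSpace ℝ (Fin 3)) R, ‖Θn n y - Θ y‖ₑ) atTop (𝓝 0) := by
    rw [hΘn]; exact tendsto_setLIntegral_mollify_sub hφ hΘ R
  have hT2 : Tendsto (fun n => ∫⁻ y in ball (0 : EuclideanSpace ℝ (Fin 3)) R, ‖Sn n y - S y‖ₑ) atTop (𝓝 0) := by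
    rw [hSn]; exact tendsto_setLIntegral_mollify_sub hφ hS R
  have hT3 : Tendsto (fun n => ∫⁻ y in ball (0 : EuclideanSpace ℝ (Fin 3)) R, ‖s n y‖ₑ) atTop (𝓝 0) := by
    simp only [hs, hΘn, hSn]
    exact tendsto_setLIntegral_commutatorVec hΘ2 hW2 hDW hDW2 htr hS heq hφ hφ2 R
  have hXt : Tendsto (fun n => ∫⁻ y in ball (0 : EuclideanSpace ℝ (Fin 3)) R,
      ‖(c • Θn n y + Sn n y - s n y) - (c • Θ y + S y)‖ₑ) atTop (𝓝 0) := by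
    have hsum : Tendsto (fun n => ‖c‖ₑ * (∫⁻ y in ball (0 : EuclideanSpace ℝ (Fin 3)) R, ‖Θn n y - Θ y‖ₑ) +
        (∫⁻ y in ball (0 : EuclideanSpace ℝ (Fin 3)) R, ‖Sn n y - S y‖ₑ) +
        ∫⁻ y in ball (0 : EuclideanSpace ℝ (Fin 3)) R, ‖s n y‖ₑ) atTop (𝓝 0) := by
      have h := ((ENNReal.Tendsto.const_mul hT1 (Or.inr (enorm_ne_top : ‖c‖ₑ ≠ ⊤))).add hT2).add hT3
      simpa using h
    refine tendsto_of_tendsto_of_tendsto_of_le_of_le' tendsto_const_nhds hsum (Eventually.of_forall fun n => bot_le)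
      (Eventually.of_forall fun n => ?_)
    have hm1 : AEMeasurable (fun y => ‖c‖ₑ * ‖Θn n y - Θ y‖ₑ) (volume.restrict (ball (0 : EuclideanSpace ℝ (Fin 3)) R)) :=
      (((hΘnm n).sub hΘ.aestronglyMeasurable).enorm.const_mul _).restrict
    have hm2 : AEMeasurable (fun y => ‖Sn n y - S y‖ₑ) (volume.restrict (ball (0 : EuclideanSpace ℝ (Fin 3)) R)) :=
      (((hSnc n).aestronglyMeasurable.sub hS.aestronglyMeasurable).enorm).restrict
    have hm12 : AEMeasurable (fun y => ‖c‖ₑ * ‖Θn n y - Θ y‖ₑ + ‖Sn n y - S y‖ₑ)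
        (volume.restrict (ball (0 : EuclideanSpace ℝ (Fin 3)) R)) := hm1.add hm2
    calc ∫⁻ y in ball (0 : EuclideanSpace ℝ (Fin 3)) R, ‖(c • Θn n y + Sn n y - s n y) - (c • Θ y + S y)‖ₑ
        ≤ ∫⁻ y in ball (0 : EuclideanSpace ℝ (Fin 3)) R, (‖c‖ₑ * ‖Θn n y - Θ y‖ₑ + ‖Sn n y - S y‖ₑ) + ‖s n y‖ₑ := by
          refine lintegral_mono fun y => ?_
          have e : (c • Θn n y + Sn n y - s n y) - (c • Θ y + S y) = (c • (Θn n y - Θ y) + (Sn n y - S y)) - s n y := by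
            rw [smul_sub]; abel
          rw [e]
          calc ‖(c • (Θn n y - Θ y) + (Sn n y - S y)) - s n y‖ₑ
              ≤ ‖c • (Θn n y - Θ y) + (Sn n y - S y)‖ₑ + ‖s n y‖ₑ := enorm_sub_le
            _ ≤ (‖c • (Θn n y - Θ y)‖ₑ + ‖Sn n y - S y‖ₑ) + ‖s n y‖ₑ := by gcongr; exact enorm_add_le _ _
            _ = (‖c‖ₑ * ‖Θn n y - Θ y‖ₑ + ‖Sn n y - S y‖ₑ) + ‖s n y‖ₑ := by rw [enorm_smul]
      _ = ‖c‖ₑ * (∫⁻ y in ball (0 : EuclideanSpace ℝ (Fin 3)) R, ‖Θn n y - Θ y‖ₑ) +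
            (∫⁻ y in ball (0 : EuclideanSpace ℝ (Fin 3)) R, ‖Sn n y - S y‖ₑ) +
            ∫⁻ y in ball (0 : EuclideanSpace ℝ (Fin 3)) R, ‖s n y‖ₑ := by
          rw [lintegral_add_left' hm12, lintegral_add_left' hm1,
            lintegral_const_mul'' _ (f := fun y => ‖Θn n y - Θ y‖ₑ) ((((hΘnm n).sub hΘ.aestronglyMeasurable).enorm).restrict)]
  have hRlim : Tendsto (fun n => ∫ y, ψ y * fderiv ℝ β (Θn n y) (c • Θn n y + Sn n y - s n y)) atTop
      (𝓝 (∫ y, ψ y * fderiv ℝ β (Θ y) (c • Θ y + S y))) :=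
    tendsto_integral_test_mul_clm_apply hψc hψs hψR hAm (fun n y => hβ'b _) (fun y => hβ'b _) hAt hXl hX'l hXt
  -- ### (IV) uniqueness of limits
  have e : (fun n => ∫ y, β (Θn n y) * (c * ψ y + fderiv ℝ ψ y (W y))) =
      fun n => ∫ y, ψ y * fderiv ℝ β (Θn n y) (c • Θn n y + Sn n y - s n y) := funext hI
  rw [e] at hL
  exact tendsto_nhds_unique hL hRlim

end Core

end Summit.NavierStokesRegularity.NavierStokesRegularity.Theorems.PowerGaugeEulerLiouville.WeakEulerian

end
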